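import Summits.QuantumFields.YangMills.Theorems.LuscherReductionTwistedTraceScalingSlowDisintegrationTubes
import Summits.QuantumFields.YangMills.Theorems.LuscherReductionTwistedTraceScalingAdjointRotationAlgebra
import Summits.QuantumFields.YangMills.Theorems.LuscherReductionTwistedTraceScalingCovariantCurl
import HarnessLib

/-!
# The transverse measure of the orthographic tube is INVARIANT under per-direction colour rotations — so the LAB-ALIGNED stiff fibre coordinate `w = R_u v`
# (in which the kinetic exponent has no slow–stiff cross term, R26) carries the same u-independent fibre measure `π`
# (lane A of S-BASE, crux `TwistedTraceScaling` stmt-QuantumFields-20203, C4 INNER; design note `pub/ym-fleet/ym-luscher-20007-p1/COARSE-DESIGN.md` §23.7)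

For `r : Fin 3 → SU(2)` let `colourRotate r v`, `(colourRotate r v)_{(x,k)} = Ad(r_k)·v_{(x,k)}` (per-direction rotation of the transverse coordinate; it preserves `capBalancedSet`).
* `chartSU2_adRot`: `P(Ad(r) v) = r·P(v)·r⁻¹`; hence ★ `orthoTube_colourRotate`: `orthoTube u (colourRotate r v) = constLift (dirCfg r) · orthoTube ((dirCfg r)⁻¹·u) v` — a colour rotation of
  the fibre is a LEFT multiplication by a constant configuration composed with a left translation of the slow variable;
* since `σ^{⊗E}` is invariant under left multiplication by constant configurations and the pulled-back tube measure is `σ^{⊗3} ⊗ π` (`…SlowDisintegration`), the map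
  `(u, v) ↦ (u·(dirCfg r)⁻¹… , colourRotate r v)` preserves it (★ `map_rotShift_slowMeasure`), and its `v`-marginal is invariant:
  ★★★ `orthoTransverse_map_colourRotate`: `(orthoTransverse L).map (colourRotate L r) = orthoTransverse L`.
WHY (§23.7, answering cdisprove R26 `…Negative/OrthoTubeKineticCross`): in the relative coordinates `v` the kinetic exponent has a first-order Coriolis cross term; in the
lab-aligned coordinates `w = R_u v` it has none (`norm_sub_sq_eq_mean_add_fluc`).  Passing from `v` to `w` fibrewise is a colour rotation depending on `u`; by this file
the fibre measure does not notice: `∫ F dσ^{⊗E} = ∫_u ∫ F(orthoTube u (R_u⁻¹ w)) dπ(w) du` with the SAME `π` (`integral_configMeasure_orthoTube` + invariance, fibre by fibre).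
HONEST FRAMING: exact measure bookkeeping for a stub of a child of the CONDITIONAL reduction route R2b1; no kernel estimate; C4 OPEN; not a gap, not Clay.
-/

set_option autoImplicit false

noncomputable section

open MeasureTheory Filter Topology Real
open scoped BigOperators Matrix
open Literature.MathematicalPhysics.QuantumFieldTheory
open Literature.MathematicalPhysics.QuantumLattice

namespace Summit.QuantumFields.YangMills.Theorems.FemtoTransferGap.TwoLattice.ConstTube

open Summit.QuantumFields.YangMills.Theorems.FemtoTransferGap
open Summit.QuantumFields.YangMills.Theorems.FemtoTransferGap.TwoLattice.SlowChart
open Summit.QuantumFields.YangMills.Theorems.FemtoTransferGap.TwoLattice.Cov (adRot_mul adRot_one sum_sq_adRot_mulVec)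

variable (L : ℕ) [NeZero L]

/-! ## §1 Colour rotations of the transverse coordinate -/

/-- Per-direction colour rotation of a transverse coordinate: `(colourRotate r v)_{(x,k)} = Ad(r_k) v_{(x,k)}`. [folklore] -/
def colourRotate (r : Fin 3 → SU2) (v : Edge 3 L → Fin 3 → ℝ) : Edge 3 L → Fin 3 → ℝ := fun e => (adRot (r e.2)).mulVec (v e)

/-- The one-site configuration with link `r_k` in direction `k`. [folklore] -/
def dirCfg (r : Fin 3 → SU2) : GaugeConfig 3 1 SU2 := fun e => r e.2

omit [NeZero L] in
/-- Colour rotations compose: `colourRotate r (colourRotate r' v) = colourRotate (r·r') v`. [folklore] -/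
theorem colourRotate_mul (r r' : Fin 3 → SU2) (v : Edge 3 L → Fin 3 → ℝ) :
    colourRotate L r (colourRotate L r' v) = colourRotate L (r * r') v := by
  funext e
  simp only [colourRotate, Pi.mul_apply, adRot_mul, Matrix.mulVec_mulVec]

omit [NeZero L] in
/-- `colourRotate 1 = id`. [folklore] -/
theorem colourRotate_one (v : Edge 3 L → Fin 3 → ℝ) : colourRotate L 1 v = v := by
  funext e; simp [colourRotate, adRot_one]

/-- Colour rotations preserve the balanced set. [folklore] -/
theorem colourRotate_mem_balancedSet {r : Fin 3 → SU2} {v : Edge 3 L → Fin 3 → ℝ} (hv : v ∈ balancedSet L) : colourRotate L r v ∈ balancedSet L := by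
  intro k a
  simp only [colourRotate, Matrix.mulVec, dotProduct]
  rw [Finset.sum_comm]
  refine Finset.sum_eq_zero fun b _ => ?_
  rw [← Finset.mul_sum, hv k b, mul_zero]

/-- Colour rotations preserve the capped balanced set. [folklore] -/
theorem colourRotate_mem_capBalancedSet {r : Fin 3 → SU2} {v : Edge 3 L → Fin 3 → ℝ} (hv : v ∈ capBalancedSet L) :
    colourRotate L r v ∈ capBalancedSet L :=
  ⟨colourRotate_mem_balancedSet L hv.1, fun e => by rw [colourRotate, sum_sq_adRot_mulVec]; exact hv.2 e⟩

omit [NeZero L] in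
/-- Colour rotations are continuous. [folklore] -/
theorem continuous_colourRotate (r : Fin 3 → SU2) : Continuous (colourRotate L r) := by
  refine continuous_pi fun e => ?_
  simp only [colourRotate]
  exact (Matrix.mulVecLin (adRot (r e.2))).continuous_of_finiteDimensional.comp (continuous_apply e)

/-- Colour rotations are measurable. [folklore] -/
theorem measurable_colourRotate (r : Fin 3 → SU2) : Measurable (colourRotate L r) := (continuous_colourRotate L r).measurable

/-- ★ `P(Ad(r) v) = r · P(v) · r⁻¹` on the closed unit ball. [cite: BrockerTomDieck1985, I (1.10)] -/
theorem chartSU2_adRot (r : SU2) {v : Fin 3 → ℝ} (hv : ∑ a, v a ^ 2 ≤ 1) : chartSU2 ((adRot r).mulVec v) = r * chartSU2 v * r⁻¹ := by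
  have hv' : ∑ a, ((adRot r).mulVec v a) ^ 2 ≤ 1 := by rw [sum_sq_adRot_mulVec]; exact hv
  refine eq_of_scalarPart_eq_of_vecPart_eq ?_ ?_
  · rw [scalarPart_chartSU2 hv', scalarPart_conj, scalarPart_chartSU2 hv, sum_sq_adRot_mulVec]
  · rw [vecPart_chartSU2 hv', vecPart_conj, vecPart_chartSU2 hv]

omit [NeZero L] in
/-- ★ **A colour rotation of the fibre is a left multiplication by a constant configuration composed with a left translation of the slow variable**:
`orthoTube u (colourRotate r v) = constLift (dirCfg r) · orthoTube ((dirCfg r)⁻¹ · u) v` (on the cap). [folklore] -/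
theorem orthoTube_colourRotate (r : Fin 3 → SU2) (u : GaugeConfig 3 1 SU2) {v : Edge 3 L → Fin 3 → ℝ} (hv : ∀ e : Edge 3 L, ∑ a, v e a ^ 2 ≤ 1) :
    orthoTube L u (colourRotate L r v) = constLift L (dirCfg r) * orthoTube L ((dirCfg r)⁻¹ * u) v := by
  funext e
  simp only [orthoTube_apply, colourRotate, Pi.mul_apply, constLift_apply, dirCfg, Pi.inv_apply]
  rw [chartSU2_adRot (r e.2) (hv e)]
  simp only [mul_assoc]

/-! ## §2 The rotation–shift map on the tube domain preserves the pulled-back measure -/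

/-- The rotation–shift map of the tube domain: `(u, v) ↦ (u · (dirCfg r)⁻¹, colourRotate r v)`. [folklore] -/
def rotShift (r : Fin 3 → SU2) (p : GaugeConfig 3 1 SU2 × capBalancedSet L) : GaugeConfig 3 1 SU2 × capBalancedSet L :=
  (p.1 * (dirCfg r)⁻¹, ⟨colourRotate L r p.2, colourRotate_mem_capBalancedSet L p.2.2⟩)

/-- The rotation–shift map is measurable. [folklore] -/
theorem measurable_rotShift (r : Fin 3 → SU2) : Measurable (rotShift L r) := by
  refine (measurable_fst.mul_const _).prodMk ?_
  exact ((measurable_colourRotate L r).comp (measurable_subtype_coe.comp measurable_snd)).subtype_mk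

/-- Under the slow embedding the rotation–shift is a LEFT multiplication by the constant configuration `constLift (dirCfg r)`. [folklore] -/
theorem slowEmb_rotShift (r : Fin 3 → SU2) (p : GaugeConfig 3 1 SU2 × capBalancedSet L) :
    slowEmb (orthoChart L) (rotShift L r p) = constLift L (dirCfg r) * slowEmb (orthoChart L) p := by
  simp only [slowEmb, rotShift, orthoChart]
  rw [mul_inv_rev, inv_inv, orthoTube_colourRotate L r _ (fun e => sum_sq_le_one_of_cap L p.2.2.2 e), ← mul_assoc, inv_mul_cancel, one_mul]

/-- `dirCfg` is multiplicative and compatible with inverses. [folklore] -/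
theorem dirCfg_inv (r : Fin 3 → SU2) : dirCfg r⁻¹ = (dirCfg r)⁻¹ := by funext e; rfl

/-- `rotShift r⁻¹` undoes `rotShift r`. [folklore] -/
theorem rotShift_inv_rotShift (r : Fin 3 → SU2) (p : GaugeConfig 3 1 SU2 × capBalancedSet L) : rotShift L r⁻¹ (rotShift L r p) = p := by
  refine Prod.ext ?_ (Subtype.ext ?_)
  · show p.1 * (dirCfg r)⁻¹ * (dirCfg r⁻¹)⁻¹ = p.1
    rw [dirCfg_inv, inv_inv, inv_mul_cancel_right]
  · show colourRotate L r⁻¹ (colourRotate L r p.2) = p.2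
    rw [colourRotate_mul, inv_mul_cancel, colourRotate_one]

/-- The image of a rotated–shifted set is the left translate of the image. [folklore] -/
theorem image_preimage_rotShift (r : Fin 3 → SU2) (s : Set (GaugeConfig 3 1 SU2 × capBalancedSet L)) :
    slowEmb (orthoChart L) '' (rotShift L r ⁻¹' s) = (fun U : GaugeConfig 3 L SU2 => constLift L (dirCfg r) * U) ⁻¹' (slowEmb (orthoChart L) '' s) := by
  ext U
  simp only [Set.mem_image, Set.mem_preimage]
  constructor
  · rintro ⟨p, hp, rfl⟩
    exact ⟨rotShift L r p, hp, slowEmb_rotShift L r p⟩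
  · rintro ⟨q, hq, hqU⟩
    refine ⟨rotShift L r⁻¹ q, ?_, ?_⟩
    · have : rotShift L r (rotShift L r⁻¹ q) = q := by simpa using rotShift_inv_rotShift L r⁻¹ q
      rw [this]; exact hq
    · have h := slowEmb_rotShift L r⁻¹ q
      rw [hqU] at h
      rw [h, ← mul_assoc, ← ConstTube.constLift_mul, dirCfg_inv, inv_mul_cancel, ConstTube.constLift_one', one_mul]

/-- ★ **The pulled-back tube measure is invariant under rotation–shifts** (left invariance of the a-priori measure under constant configurations). [folklore] -/
theorem map_rotShift_slowMeasure (r : Fin 3 → SU2) : (slowMeasure (orthoChart L)).map (rotShift L r) = slowMeasure (orthoChart L) := by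
  haveI : PolishSpace (capBalancedSet L) := (isClosed_capBalancedSet L).polishSpace
  haveI : (configMeasure SU2 L).IsMulLeftInvariant := by unfold configMeasure; infer_instance
  ext s hs
  rw [Measure.map_apply (measurable_rotShift L r) hs, slowMeasure_apply (continuous_orthoChart L) (orthoChart_injective L),
    slowMeasure_apply (continuous_orthoChart L) (orthoChart_injective L), image_preimage_rotShift, measure_preimage_mul]

/-! ## §3 ★★★ Invariance of the transverse measure -/

/-- ★★★ **THE TRANSVERSE MEASURE IS INVARIANT UNDER PER-DIRECTION COLOUR ROTATIONS**: `(orthoTransverse L).map (colourRotate r) = orthoTransverse L`. [folklore] -/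
theorem orthoTransverse_map_colourRotate (r : Fin 3 → SU2) : (orthoTransverse L).map (colourRotate L r) = orthoTransverse L := by
  haveI : PolishSpace (capBalancedSet L) := (isClosed_capBalancedSet L).polishSpace
  -- the restricted rotation on the subtype
  set R : capBalancedSet L → capBalancedSet L := fun v => ⟨colourRotate L r v, colourRotate_mem_capBalancedSet L v.2⟩ with hR
  have hRm : Measurable R := ((measurable_colourRotate L r).comp measurable_subtype_coe).subtype_mk
  have hval : Subtype.val ∘ R = colourRotate L r ∘ Subtype.val := rfl
  have hsnd : Prod.snd ∘ rotShift L r = R ∘ Prod.snd := rfl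
  unfold orthoTransverse slowMarginal
  rw [Measure.map_map (measurable_colourRotate L r) measurable_subtype_coe, ← hval, ← Measure.map_map measurable_subtype_coe hRm,
    Measure.map_map hRm measurable_snd, ← hsnd, ← Measure.map_map measurable_snd (measurable_rotShift L r), map_rotShift_slowMeasure]

/-- ★★★ **Integration against the rotated transverse coordinate**: for measurable `g ≥ 0`-or-bounded… (change of variables):
`∫ g(colourRotate r v) dπ(v) = ∫ g(v) dπ(v)`. [folklore] -/
theorem integral_orthoTransverse_colourRotate (r : Fin 3 → SU2) (g : (Edge 3 L → Fin 3 → ℝ) → ℝ) (hg : Measurable g) :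
    ∫ v, g (colourRotate L r v) ∂orthoTransverse L = ∫ v, g v ∂orthoTransverse L := by
  have h := integral_map (μ := orthoTransverse L) (measurable_colourRotate L r).aemeasurable (f := g) hg.aestronglyMeasurable
  rw [orthoTransverse_map_colourRotate] at h
  exact h.symm

end Summit.QuantumFields.YangMills.Theorems.FemtoTransferGap.TwoLattice.ConstTube

end
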